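import Summits.ABC.IUTFork.LDHSlotRegimePointNecessity
import Summits.ABC.IUTFork.ForkGenuineWindowSharpLogDiff
import Summits.ABC.IUTFork.LDHGenuineStepVPoint
import HarnessLib

/-!
# The fork at [IUTchIII] Corollary 3.12, L-DH level, READING (U): the SHARP necessity half READ ON THE POINT in the mixed-height
# currency — `hvol(λ, l)` FORCES «mixed bad local height of `j(λ)` (all mixed primes summed) PLUS `((l+5)/4 − d_mod)`
# log-differents of `K` ≤ B_III(λ, l)» (abc-iut cell, R2 S-chain team seat abc-iut-s2-p1 gen 2; crux ThetaPartII = stmt-ABC-19678;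
# CONE binder `hvol` / `hreg` of `abc_of_S_v3` / `abc_of_S_v4` / `abc_of_SH_v10M`)

Record-only PROOF file (D-0012) of the abc-iut cell; TAKES NO SIDE on [IUTchIII] Cor. 3.12 or on the (U)/(P) readings of
"−|log(Θ)|". Mochizuki, *Inter-universal Teichmüller theory IV* (RIMS manuscript Apr. 2020 = PRIMS **57** (2021)), Thm. 1.10 proof
Steps (ii) p. 24, (v) pp. 27–28; Cor. 2.2 (ii) proof p. 46 ((P5), (P7)); Dupuy–Hilado [DupuyHilado2025] §3.3, §3.6, §4.7, §4.11–4.12.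

Sequel to this seat's `LDHSlotRegimePointNecessity` (gen 0, p438393: `hvol` ⟹ the mixed-share inequality on the point, from abc-iut-S8's
forced slot residue `slotResidue(T) ≤ δ`). abc-iut-w6-d018's «Rest_lower» chain (`TensorPacketDifferentSharp`, `TensorPacketContentSharp`,
`ForkGenuineWindowSharp`) and abc-iut-S4's `ForkGenuineWindowSharpExplicit` / `ForkGenuineWindowSharpLogDiff` SHARPEN S8's half to
`slotResidue(T) + ((ℓ⋇+3)/2 − [F_mod:ℚ])·log(𝔡^K) ≤ δ` (`GenuineContent.slotResidue_add_mul_ndeg_le_of_hullEstimateOf`, `K/F_mod` Galois):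
the hull of the union of possible images REALISES the packets' differents against their least factor's ([IUTchIV] Prop. 1.1 read
backwards), i.e. all but `[F_mod:ℚ]` unweighted copies of the `((l+5)/4)·log(𝔡^K)`-shaped term that Step (v) allocates. THIS FILE
reads that sharpening ON THE POINT in the currency of the gen-0 sandwich (abc-iut-s2-p2's closed mixed-share lower bound of the
residue, `slotResidue_ge_mixedShare_closed_of_support`; this seat's transport `sum_goodWeight_eq_point` / `sum_badHeight_mul_weight_eq_point_div`):
`F_mod := ℚ(j(λ)) ⊆ F_tpd`; `V` (P5)-bad iff `ord_V j(λ) < 0`, `V ∤ 2`, `V ∤ l`; `h♭(V) := (−ord_V j(λ))·log N(V)/n_V` at bad `V`, else `0`;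
`S(p) := Σ_{V|p bad} Pr(V)·h♭(V)`; `ω_p := Σ_{V|p not bad} Pr(V)` (all inline; no definition).

* `DHData.mixedShare_add_mul_ndeg_le_of_hullEstimateOf` — input level (`K/F₀` Galois): `HullEstimateOf I δ` ⟹
  `Σ_{p∈W} μ̄_p·(c_ℓ − 2(1−ω_p)/(ℓ⋆·ω_p³)) + ((ℓ⋇+3)/2 − [F₀:ℚ])·log(𝔡^K) ≤ δ`;
* `PointDict.mixedShare_add_mulNdeg_le_of_hullEstimateOf` — at a datum `T` of `(P, l)`, in printed quantities, coefficient
  `(l+5)/4 − d_mod` (`ℓ⋇ = (l−1)/2`, `[F_mod(E_F):ℚ] = d_mod(λ)`);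
* **`PointDict.pointMixedShare_add_mulNdeg_le_of_hullVolumeAtDatum`** — `Cor22.HullVolumeAtDatum P l δ` + a datum `T` ⟹ for every finite
  set `W` of primes with `ω_p > 0`: `Σ_{p∈W} (S(p)/(2l))·(l(l+1)/12 − 4(1−ω_p)/((l−1)ω_p³)) + ((l+5)/4 − d_mod)·log(𝔡^{T.K}) ≤ δ` — the ONLY
  datum-dependence left is the normalised log-different `log(𝔡^K) = ndeg T.K (differentDivisor T.K)` of the datum's `K = F(E_F[l])`;
* **`PointDict.pointMixedShare_add_mulNdeg_le_BIII_of_hvol`** — from `abc_of_S_v3`'s CONE binder `hvol` VERBATIM, at every admissible `(λ, l)`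
  and EVERY datum there (data exist: abc-iut-L5-t7's `ThetaPartII.stub_thetaData`), with `δ = B_III(λ,l)`.

READING (for the planners; numbers, not a side). `B_III(λ,l) = ((l+1)/4)·((1 + 12d_mod/l)(log𝔡^{F_tpd} + log𝔣^{F_tpd}) + 2 log l + 52 + π-term)`;
print's Step (ii) bounds `log(𝔡^K) ≤ log𝔡^{F_tpd} + log𝔣^{F_tpd} + 2 log l + O(1)` from ABOVE, and `log(𝔡^K) ≥ log𝔡^{F_tpd} + (1 − 1/l)·log𝔣^{F_tpd}`
from below (abc-iut-S4, announced): so for `l ≥ 4d_mod` the gain `((l+5)/4 − d_mod)·log(𝔡^K)` CANCELS the `((l+1)/4)·1·(log𝔡 + log𝔣)` of `B_III`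
up to `O(d_mod)·(log𝔡 + log𝔣)`, and `hvol(λ,l)` demands «`((l+1)/24)·Σ_{p mixed} S(p)·(1 − tail) ≲ O(d_mod + d_mod²/l)·(log𝔡+log𝔣) + ((l+1)/4)·(2 log l + 52 +
(20/3)·log(d*l)·π(d*l))`» — the WHOLE mixed bad height of `λ` against print's rounding and prime-count slack, not against the conductor
(gen 0's p438393 had the full `B_III` on the right). With the SUFFICIENCY half of gen 0 (`hullVolumeAtDatum_BIII_of_pointMixedHeight_le_szpiroMax`,
p438083) the CONE binder is now sandwiched on the SAME sums `S(p)` with right-hand sides that agree in the leading `l·(conductor)` order.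
HONEST SCOPE: compositions and transport bookkeeping; no datum constructed; nothing asserted about any point; no side taken on Cor. 3.12 /
Thm. 1.10 or on any author; typed ≠ proved. PROOF-ONLY file: no definitions, no named `Prop` facts.
[cite: Mochizuki2012, IUTchIV Thm. 1.10 proof Step (ii) p. 24, Step (v) p. 27–28] [cite: Mochizuki2012, IUTchIV Cor. 2.2 (ii) proof p. 46]
[cite: Mochizuki2012, IUTchIV Prop. 1.1 p. 9] [cite: DupuyHilado2025, §3.3, §3.6, §4.7, §4.12] [claim: Mochizuki2012, status: disputed]
for every IUT quotation.
-/

noncomputable section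

namespace Summit.ABC.IUTFork

open NumberField IsDedekindDomain Literature.IUT.LogVolume Literature.IUT.HodgeTheaters
open Literature.NumberTheory.DiophantineGeometry.GenEll Literature.NumberTheory.NumberFields
open scoped Classical

/-! ## Genuine Θ-volume inputs: mixed share PLUS different gain -/

namespace DHData

section Input

variable {F₀ : Type} [Field F₀] [NumberField F₀] {K : Type} [Field K] [NumberField K] [Algebra F₀ K]
variable (I : ThetaVolumeInput F₀ K)

/-- **For every genuine Θ-volume input with `K/F₀` Galois**: `HullEstimateOf I δ` forces
`Σ_{p∈W} μ̄_p·(c_ℓ − 2(1−ω_p)/(ℓ⋆·ω_p³)) + ((ℓ⋇+3)/2 − [F₀:ℚ])·log(𝔡^K) ≤ δ` for every finite set of primes `W` and zero-sets of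
positive weight outside `S` — abc-iut-s2-p2's closed mixed-share lower bound of the (Ind1) slot residue
(`slotResidue_ge_mixedShare_closed_of_support`) against abc-iut-S4's sharp upper end
`GenuineContent.slotResidue_add_mul_ndeg_le_of_hullEstimateOf` (over abc-iut-w6-d018's `ForkGenuineWindowSharp`).
[cite: Mochizuki2012, IUTchIV Thm. 1.10 Step (v) p. 27–28] [cite: Mochizuki2012, IUTchIV Prop. 1.1 p. 9] [cite: DupuyHilado2025, §4.7, §4.12] -/
theorem mixedShare_add_mul_ndeg_le_of_hullEstimateOf [IsGalois F₀ K] {δ : ℝ} (h : I.HullEstimateOf δ) (W : Finset ℕ)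
    (hW : ∀ p ∈ W, p.Prime) (Z : (p : ℕ) → Finset (placesOver F₀ p)) (hZ : ∀ p ∈ W, ∀ v ∈ Z p, v.1 ∉ I.X.S)
    (hω : ∀ p ∈ W, 0 < ∑ v ∈ Z p, weight F₀ v.1) :
    ∑ p ∈ W, (∑ v : placesOver F₀ p, I.X.qPilot v.1 * logNorm F₀ v.1 / (localDegree F₀ v.1 : ℝ) * weight F₀ v.1) *
        ((((I.X.lstar : ℝ) + 1) * (2 * I.X.lstar + 1) / 6)
          - 2 * (1 - ∑ v ∈ Z p, weight F₀ v.1) / ((I.X.lstar : ℝ) * (∑ v ∈ Z p, weight F₀ v.1) ^ 3))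
      + (((I.X.lstar : ℝ) + 3) / 2 - Module.finrank ℚ F₀) * ndeg K (differentDivisor K) ≤ δ := by
  have h1 := I.X.slotResidue_ge_mixedShare_closed_of_support I.supportPrimes W (fun _ hp => I.prime_of_mem_supportPrimes hp)
    (fun _ hv => I.residueChar_mem_supportPrimes hv) hW Z hZ hω
  have h2 := GenuineContent.slotResidue_add_mul_ndeg_le_of_hullEstimateOf I h
  linarith

end Input

end DHData

/-! ## At the `λ`-line: what child (ii′)/(U) asserts at `d_mod ≥ 2`, residue AND different gain, ON THE POINT -/

namespace PointDict

variable {P : NFPoint} {l : ℕ}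

/-- **At a datum of `(P, l)`, in printed quantities.** If `T.HullEstimateOf δ`, then for every finite set `W` of rational primes such
that over each `p ∈ W` the places of `F_mod(E_F)` OUTSIDE `𝕍^bad_mod` carry positive weight `ω_p`:
`Σ_{p∈W} (Σ_{v|p, v∈𝕍^bad_mod} Pr(v)·(−ord_v(j_E))/(2l)·ln N(v)/n_v)·(l(l+1)/12 − 4(1−ω_p)/((l−1)·ω_p³)) + ((l+5)/4 − d_mod)·log(𝔡^K) ≤ δ`
(`ℓ⋇ = (l−1)/2`: `lstar_cast_eq`; `[F_mod(E_F):ℚ] = d_mod(λ)`: abc-iut-c312-8's `dmod_eq_of_j_extend`; `K/F_mod` Galois: the datum's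
`isGalois_fieldOfModuli_K`). [cite: Mochizuki2012, IUTchIV Thm. 1.10 Step (v) p. 27–28] [cite: DupuyHilado2025, §3.3, §3.6, §4.7, §4.12]
[claim: Mochizuki2012, status: disputed] -/
theorem mixedShare_add_mulNdeg_le_of_hullEstimateOf (T : Cor22.ThetaVolumeDatumAt P l) {δ : ℝ} (h : T.HullEstimateOf δ) :
    (letI := T.instFieldF; letI := T.instNumberFieldF; letI := T.instAlgebraF; letI := T.instFieldK
     letI := T.instNumberFieldK; letI := T.instAlgebraK; letI := T.instFieldFbar; letI := T.instAlgebraFbar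
     letI := T.instAlgebraKFbar; letI := T.instIsElliptic
     ∀ W : Finset ℕ, (∀ p ∈ W, p.Prime) →
       (∀ p ∈ W, 0 < ∑ v ∈ Finset.univ.filter
          (fun v : placesOver (fieldOfModuli T.E) p => v.1 ∉ ThetaData.badPrimesMod T.D),
            weight (fieldOfModuli T.E) v.1) →
       ∑ p ∈ W, (∑ v : placesOver (fieldOfModuli T.E) p,
           (if v.1 ∈ ThetaData.badPrimesMod T.D then
               ((-ord (fieldOfModuli T.E) v.1 (ThetaData.jMod T.E) : ℤ) : ℝ) / (2 * (l : ℝ)) *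
                 logNorm (fieldOfModuli T.E) v.1 / (localDegree (fieldOfModuli T.E) v.1 : ℝ)
             else 0) * weight (fieldOfModuli T.E) v.1) *
         ((l : ℝ) * ((l : ℝ) + 1) / 12
           - 4 * (1 - ∑ v ∈ Finset.univ.filter
                (fun v : placesOver (fieldOfModuli T.E) p => v.1 ∉ ThetaData.badPrimesMod T.D),
                  weight (fieldOfModuli T.E) v.1) /
             (((l : ℝ) - 1) * (∑ v ∈ Finset.univ.filter
                (fun v : placesOver (fieldOfModuli T.E) p => v.1 ∉ ThetaData.badPrimesMod T.D),
                  weight (fieldOfModuli T.E) v.1) ^ 3))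
         + (((l : ℝ) + 5) / 4 - Cor22.dmod P) * ndeg T.K (differentDivisor T.K) ≤ δ) := by
  letI := T.instFieldF; letI := T.instNumberFieldF; letI := T.instAlgebraF; letI := T.instFieldK
  letI := T.instNumberFieldK; letI := T.instAlgebraK; letI := T.instFieldFbar; letI := T.instAlgebraFbar
  letI := T.instAlgebraKFbar; letI := T.instIsElliptic
  haveI := T.isGalois_fieldOfModuli_K
  intro W hW hω
  have hZ : ∀ p ∈ W, ∀ v ∈ Finset.univ.filter
      (fun v : placesOver (fieldOfModuli T.E) p => v.1 ∉ ThetaData.badPrimesMod T.D), v.1 ∉ T.I.X.S := by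
    intro p _ v hv
    rw [(X_S_eq T).1]
    exact (Finset.mem_filter.mp hv).2
  have hmain := DHData.mixedShare_add_mul_ndeg_le_of_hullEstimateOf T.I h W hW
    (fun p => Finset.univ.filter
      (fun v : placesOver (fieldOfModuli T.E) p => v.1 ∉ ThetaData.badPrimesMod T.D)) hZ hω
  have hl1 : (T.I.X.lstar : ℝ) = ((l : ℝ) - 1) / 2 := lstar_cast_eq T
  have hc : ((T.I.X.lstar : ℝ) + 1) * (2 * T.I.X.lstar + 1) / 6 = (l : ℝ) * ((l : ℝ) + 1) / 12 := avgSq_eq T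
  have hd : (Module.finrank ℚ (fieldOfModuli T.E) : ℝ) = (Cor22.dmod P : ℝ) := by
    exact_mod_cast PointStepV.finrank_fieldOfModuli_eq_dmod T
  have hcoef : ((T.I.X.lstar : ℝ) + 3) / 2 - (Module.finrank ℚ (fieldOfModuli T.E) : ℝ) =
      ((l : ℝ) + 5) / 4 - (Cor22.dmod P : ℝ) := by
    rw [hl1, hd]; ring
  rw [hcoef] at hmain
  refine le_trans (le_of_eq ?_) hmain
  congr 1
  refine Finset.sum_congr rfl fun p hp => ?_
  rw [sum_mu_weight_eq T p, hc, hl1]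
  congr 1
  have hωp := hω p hp
  have hl2 : ((l : ℝ) - 1) ≠ 0 := by
    have : (0 : ℝ) < T.I.X.lstar := by
      have := T.I.X.two_le_lstar; exact_mod_cast (by omega : 0 < T.I.X.lstar)
    rw [hl1] at this
    intro h0; rw [h0] at this; simp at this
  field_simp
  ring

/-- **SHARP NECESSITY ON THE POINT.** `Cor22.HullVolumeAtDatum P l δ` (the conclusion of the CONE binder `hvol` / the stubs
`stub_hullVolume`, `stub_hullRegime`, `stub_hullRegimeAbove`) and a genuine Θ-volume datum `T` at `(P, l)` force, for every finite set `W`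
of primes each under a non-(P5)-bad place of `ℚ(j(λ))` of positive total weight `ω_p`:
`Σ_{p∈W} (S(p)/(2l))·(l(l+1)/12 − 4(1−ω_p)/((l−1)·ω_p³)) + ((l+5)/4 − d_mod)·log(𝔡^{T.K}) ≤ δ` — this seat's gen-0
`pointMixedShare_le_of_hullVolumeAtDatum` with abc-iut-w6-d018/S4's realised different gain added on the left. The residue side
mentions NO datum and NO IUT object; the gain is the normalised log-different of the datum's `K = F(E_F[l])`.
[cite: Mochizuki2012, IUTchIV Thm. 1.10 proof Step (v) p. 27–28] [cite: Mochizuki2012, IUTchIV Prop. 1.1 p. 9]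
[cite: DupuyHilado2025, §3.3, §3.6, §4.7, §4.12] [claim: Mochizuki2012, status: disputed] -/
theorem pointMixedShare_add_mulNdeg_le_of_hullVolumeAtDatum {δ : ℝ} (h : Cor22.HullVolumeAtDatum P l δ)
    (T : Cor22.ThetaVolumeDatumAt P l) (W : Finset ℕ) (hW : ∀ p ∈ W, p.Prime)
    (hω : ∀ p ∈ W, 0 < ∑ V ∈ Finset.univ.filter
        (fun V : placesOver ↥(IntermediateField.adjoin ℚ ({Cor22.jInv P.x} : Set P.F)) p =>
          ¬ (ord _ V.1 (Cor22.jMod P) < 0 ∧ ((2 : ℕ) : 𝓞 _) ∉ V.1.asIdeal ∧ ((l : ℕ) : 𝓞 _) ∉ V.1.asIdeal)),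
        weight _ V.1) :
    ∑ p ∈ W, (1 / (2 * (l : ℝ)) * ∑ V : placesOver ↥(IntermediateField.adjoin ℚ ({Cor22.jInv P.x} : Set P.F)) p,
        (if ord _ V.1 (Cor22.jMod P) < 0 ∧ ((2 : ℕ) : 𝓞 _) ∉ V.1.asIdeal ∧ ((l : ℕ) : 𝓞 _) ∉ V.1.asIdeal then
          weight _ V.1 * (((-ord _ V.1 (Cor22.jMod P) : ℤ) : ℝ) * logNorm _ V.1 / (localDegree _ V.1 : ℝ))
         else 0)) *
      ((l : ℝ) * ((l : ℝ) + 1) / 12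
        - 4 * (1 - ∑ V ∈ Finset.univ.filter
              (fun V : placesOver ↥(IntermediateField.adjoin ℚ ({Cor22.jInv P.x} : Set P.F)) p =>
                ¬ (ord _ V.1 (Cor22.jMod P) < 0 ∧ ((2 : ℕ) : 𝓞 _) ∉ V.1.asIdeal ∧ ((l : ℕ) : 𝓞 _) ∉ V.1.asIdeal)),
              weight _ V.1) /
          (((l : ℝ) - 1) * (∑ V ∈ Finset.univ.filter
              (fun V : placesOver ↥(IntermediateField.adjoin ℚ ({Cor22.jInv P.x} : Set P.F)) p =>
                ¬ (ord _ V.1 (Cor22.jMod P) < 0 ∧ ((2 : ℕ) : 𝓞 _) ∉ V.1.asIdeal ∧ ((l : ℕ) : 𝓞 _) ∉ V.1.asIdeal)),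
              weight _ V.1) ^ 3))
      + (((l : ℝ) + 5) / 4 - Cor22.dmod P) *
        (letI := T.instFieldK; letI := T.instNumberFieldK
         ndeg T.K (differentDivisor T.K)) ≤ δ := by
  letI := T.instFieldF; letI := T.instNumberFieldF; letI := T.instAlgebraF; letI := T.instFieldK
  letI := T.instNumberFieldK; letI := T.instAlgebraK; letI := T.instFieldFbar; letI := T.instAlgebraFbar
  letI := T.instAlgebraKFbar; letI := T.instIsElliptic
  have hω' : ∀ p ∈ W, 0 < ∑ v ∈ Finset.univ.filter
      (fun v : placesOver ↥(fieldOfModuli T.E) p => v.1 ∉ ThetaData.badPrimesMod T.D), weight ↥(fieldOfModuli T.E) v.1 := by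
    intro p hp
    haveI : Fact p.Prime := ⟨hW p hp⟩
    rw [sum_goodWeight_eq_point T p]
    exact hω p hp
  have hs2 := mixedShare_add_mulNdeg_le_of_hullEstimateOf T (h T) W hW hω'
  refine le_of_eq_of_le ?_ hs2
  congr 1
  refine Finset.sum_congr rfl fun p hp => ?_
  haveI : Fact p.Prime := ⟨hW p hp⟩
  rw [sum_badHeight_mul_weight_eq_point_div T p, sum_goodWeight_eq_point T p]

/-- **SHARP NECESSITY ON THE POINT, FROM THE CONE BINDER.** From `abc_of_S_v3`'s `hvol` VERBATIM: at every admissible `(λ, l)` (`λ ∈ U_X`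
minimal, `l` prime `≥ 5`, «admits an `F`-core», (P2), (P5), (P6)), EVERY genuine Θ-volume datum `T` there (such data EXIST: abc-iut-L5-t7's
`ThetaPartII.stub_thetaData`) and every finite set `W` of primes each under a non-(P5)-bad place of `ℚ(j(λ))` of positive weight `ω_p`:
`Σ_{p∈W} (S(p)/(2l))·(l(l+1)/12 − 4(1−ω_p)/((l−1)·ω_p³)) + ((l+5)/4 − d_mod)·log(𝔡^{T.K}) ≤ B_III(λ, l)` — an abc/Szpiro-type inequality on the
`Pr`-weighted local heights of `j(λ)` at the mixed primes in which all but `O(d_mod)` of the `(l+1)/4`-fold conductor credit of `B_III` is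
spent on the datum's own log-different. [cite: Mochizuki2012, IUTchIV Thm. 1.10 proof Step (v) p. 27–28]
[cite: Mochizuki2012, IUTchIV Cor. 2.2 (ii) proof p. 46] [claim: Mochizuki2012, status: disputed] -/
theorem pointMixedShare_add_mulNdeg_le_BIII_of_hvol
    (hvol : ∀ P₀ : NFPoint, P₀ ∈ UP → ∀ l : ℕ, l.Prime → 5 ≤ l →
      Cor22.AdmitsCore P₀ → Cor22.CondP2 P₀ l → Cor22.CondP5 P₀ l → Cor22.CondP6 P₀ l →
        Cor22.HullVolumeAtDatum P₀ l (((l : ℝ) + 1) / 4 *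
          ((1 + 12 * (Cor22.dmod P₀ : ℝ) / l) * (P₀.logDiff + Cor22.logCondAvoid P₀ {2, l})
            + 2 * Real.log l + 52
            + 20 / 3 * Real.log (((2 ^ 12 * 3 ^ 3 * 5 * Cor22.dmod P₀ : ℕ) : ℝ) * (l : ℝ))
              * (Nat.primeCounting (2 ^ 12 * 3 ^ 3 * 5 * Cor22.dmod P₀ * l) : ℝ))))
    (hP : P ∈ UP) (hl : l.Prime) (h5 : 5 ≤ l) (hcore : Cor22.AdmitsCore P) (h2 : Cor22.CondP2 P l)
    (h5' : Cor22.CondP5 P l) (h6 : Cor22.CondP6 P l)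
    (T : Cor22.ThetaVolumeDatumAt P l) (W : Finset ℕ) (hW : ∀ p ∈ W, p.Prime)
    (hω : ∀ p ∈ W, 0 < ∑ V ∈ Finset.univ.filter
        (fun V : placesOver ↥(IntermediateField.adjoin ℚ ({Cor22.jInv P.x} : Set P.F)) p =>
          ¬ (ord _ V.1 (Cor22.jMod P) < 0 ∧ ((2 : ℕ) : 𝓞 _) ∉ V.1.asIdeal ∧ ((l : ℕ) : 𝓞 _) ∉ V.1.asIdeal)),
        weight _ V.1) :
    ∑ p ∈ W, (1 / (2 * (l : ℝ)) * ∑ V : placesOver ↥(IntermediateField.adjoin ℚ ({Cor22.jInv P.x} : Set P.F)) p,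
        (if ord _ V.1 (Cor22.jMod P) < 0 ∧ ((2 : ℕ) : 𝓞 _) ∉ V.1.asIdeal ∧ ((l : ℕ) : 𝓞 _) ∉ V.1.asIdeal then
          weight _ V.1 * (((-ord _ V.1 (Cor22.jMod P) : ℤ) : ℝ) * logNorm _ V.1 / (localDegree _ V.1 : ℝ))
         else 0)) *
      ((l : ℝ) * ((l : ℝ) + 1) / 12
        - 4 * (1 - ∑ V ∈ Finset.univ.filter
              (fun V : placesOver ↥(IntermediateField.adjoin ℚ ({Cor22.jInv P.x} : Set P.F)) p =>
                ¬ (ord _ V.1 (Cor22.jMod P) < 0 ∧ ((2 : ℕ) : 𝓞 _) ∉ V.1.asIdeal ∧ ((l : ℕ) : 𝓞 _) ∉ V.1.asIdeal)),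
              weight _ V.1) /
          (((l : ℝ) - 1) * (∑ V ∈ Finset.univ.filter
              (fun V : placesOver ↥(IntermediateField.adjoin ℚ ({Cor22.jInv P.x} : Set P.F)) p =>
                ¬ (ord _ V.1 (Cor22.jMod P) < 0 ∧ ((2 : ℕ) : 𝓞 _) ∉ V.1.asIdeal ∧ ((l : ℕ) : 𝓞 _) ∉ V.1.asIdeal)),
              weight _ V.1) ^ 3))
      + (((l : ℝ) + 5) / 4 - Cor22.dmod P) *
        (letI := T.instFieldK; letI := T.instNumberFieldK
         ndeg T.K (differentDivisor T.K)) ≤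
      ((l : ℝ) + 1) / 4 * ((1 + 12 * (Cor22.dmod P : ℝ) / l) * (P.logDiff + Cor22.logCondAvoid P {2, l})
        + 2 * Real.log l + 52 + 20 / 3 * Real.log (((2 ^ 12 * 3 ^ 3 * 5 * Cor22.dmod P : ℕ) : ℝ) * (l : ℝ))
          * (Nat.primeCounting (2 ^ 12 * 3 ^ 3 * 5 * Cor22.dmod P * l) : ℝ)) :=
  pointMixedShare_add_mulNdeg_le_of_hullVolumeAtDatum (hvol P hP l hl h5 hcore h2 h5' h6) T W hW hω

/-- **Data exist at every admissible `(λ, l)`** (abc-iut-L5-t7's `ThetaPartII.stub_thetaData`), so the `∀ T` above is never vacuous: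
recorded as the `∃`-form of `pointMixedShare_add_mulNdeg_le_BIII_of_hvol`. [cite: Mochizuki2012, IUTchIV Cor. 2.2 (ii) proof p. 46]
[claim: Mochizuki2012, status: disputed] -/
theorem exists_datum_pointMixedShare_add_mulNdeg_le_BIII_of_hvol
    (hvol : ∀ P₀ : NFPoint, P₀ ∈ UP → ∀ l : ℕ, l.Prime → 5 ≤ l →
      Cor22.AdmitsCore P₀ → Cor22.CondP2 P₀ l → Cor22.CondP5 P₀ l → Cor22.CondP6 P₀ l →
        Cor22.HullVolumeAtDatum P₀ l (((l : ℝ) + 1) / 4 *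
          ((1 + 12 * (Cor22.dmod P₀ : ℝ) / l) * (P₀.logDiff + Cor22.logCondAvoid P₀ {2, l})
            + 2 * Real.log l + 52
            + 20 / 3 * Real.log (((2 ^ 12 * 3 ^ 3 * 5 * Cor22.dmod P₀ : ℕ) : ℝ) * (l : ℝ))
              * (Nat.primeCounting (2 ^ 12 * 3 ^ 3 * 5 * Cor22.dmod P₀ * l) : ℝ))))
    (hP : P ∈ UP) (hl : l.Prime) (h5 : 5 ≤ l) (hcore : Cor22.AdmitsCore P) (h2 : Cor22.CondP2 P l)
    (h5' : Cor22.CondP5 P l) (h6 : Cor22.CondP6 P l)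
    (W : Finset ℕ) (hW : ∀ p ∈ W, p.Prime)
    (hω : ∀ p ∈ W, 0 < ∑ V ∈ Finset.univ.filter
        (fun V : placesOver ↥(IntermediateField.adjoin ℚ ({Cor22.jInv P.x} : Set P.F)) p =>
          ¬ (ord _ V.1 (Cor22.jMod P) < 0 ∧ ((2 : ℕ) : 𝓞 _) ∉ V.1.asIdeal ∧ ((l : ℕ) : 𝓞 _) ∉ V.1.asIdeal)),
        weight _ V.1) :
    ∃ T : Cor22.ThetaVolumeDatumAt P l,
    ∑ p ∈ W, (1 / (2 * (l : ℝ)) * ∑ V : placesOver ↥(IntermediateField.adjoin ℚ ({Cor22.jInv P.x} : Set P.F)) p,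
        (if ord _ V.1 (Cor22.jMod P) < 0 ∧ ((2 : ℕ) : 𝓞 _) ∉ V.1.asIdeal ∧ ((l : ℕ) : 𝓞 _) ∉ V.1.asIdeal then
          weight _ V.1 * (((-ord _ V.1 (Cor22.jMod P) : ℤ) : ℝ) * logNorm _ V.1 / (localDegree _ V.1 : ℝ))
         else 0)) *
      ((l : ℝ) * ((l : ℝ) + 1) / 12
        - 4 * (1 - ∑ V ∈ Finset.univ.filter
              (fun V : placesOver ↥(IntermediateField.adjoin ℚ ({Cor22.jInv P.x} : Set P.F)) p =>
                ¬ (ord _ V.1 (Cor22.jMod P) < 0 ∧ ((2 : ℕ) : 𝓞 _) ∉ V.1.asIdeal ∧ ((l : ℕ) : 𝓞 _) ∉ V.1.asIdeal)),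
              weight _ V.1) /
          (((l : ℝ) - 1) * (∑ V ∈ Finset.univ.filter
              (fun V : placesOver ↥(IntermediateField.adjoin ℚ ({Cor22.jInv P.x} : Set P.F)) p =>
                ¬ (ord _ V.1 (Cor22.jMod P) < 0 ∧ ((2 : ℕ) : 𝓞 _) ∉ V.1.asIdeal ∧ ((l : ℕ) : 𝓞 _) ∉ V.1.asIdeal)),
              weight _ V.1) ^ 3))
      + (((l : ℝ) + 5) / 4 - Cor22.dmod P) *
        (letI := T.instFieldK; letI := T.instNumberFieldK
         ndeg T.K (differentDivisor T.K)) ≤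
      ((l : ℝ) + 1) / 4 * ((1 + 12 * (Cor22.dmod P : ℝ) / l) * (P.logDiff + Cor22.logCondAvoid P {2, l})
        + 2 * Real.log l + 52 + 20 / 3 * Real.log (((2 ^ 12 * 3 ^ 3 * 5 * Cor22.dmod P : ℕ) : ℝ) * (l : ℝ))
          * (Nat.primeCounting (2 ^ 12 * 3 ^ 3 * 5 * Cor22.dmod P * l) : ℝ)) := by
  obtain ⟨T⟩ := Summit.ABC.ABC.Theorems.ThetaPartII.stub_thetaData P hP l hl h5 hcore h2 h5' h6
  exact ⟨T, pointMixedShare_add_mulNdeg_le_BIII_of_hvol hvol hP hl h5 hcore h2 h5' h6 T W hW hω⟩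

end PointDict

end Summit.ABC.IUTFork

end
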